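import Summits.PneNP.PneNP.Theorems.SymmetryBudgetNoHiddenOrderPerPathAtoms
import Summits.PneNP.PneNP.Theorems.SymmetryBudgetNoHiddenOrderLogBranchSumTransition
import Summits.PneNP.PneNP.Theorems.SymmetryBudgetNoHiddenOrderPerPathFatNodes

/-!
# OR-steps of the components-only Corneil–Goldberg process are transition data (`NoHiddenOrder`, (R1) of PER-PATH.md §11)

Route `PneNP/SymmetryBudget`, `NoHiddenOrder` (stmt-PneNP-14781). Along the path of a pointer `p` through the components-only
recursion tree (PER-PATH.md §1 with the rule "split by switching components, iterated to a fixed point" = `BranchSum.atom` of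
`…PerPathAtomsDefs/Atoms.lean`), an OR-step at node `k` consists of: the vertex `x k` individualised (in a smallest cell), an
equitable-inside-`W k` refinement `colStar k` of `col k` in which `x k` is a singleton, and the next block
`W (k+1) = atom G (W k) (colStar k) (p k)` with `col (k+1) = colStar k`. `ORSteps G N` records exactly this for the `N` OR-nodes
of a path (root data: `col 0` equitable inside `W 0` with connected switching graph). We derive every hypothesis of seat -2's
`BranchSum.TransitionData` (`ORSteps.toTransitionData`): equitability and connectivity propagate (`equitableIn_atom`,
`atom_connected`), dropped vertices are homogeneous (`atom_homogeneous`), cells at OR-nodes have `≥ 2` elements (a singleton cell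
is switching-isolated, `not_swAdj_of_cell_singleton`, contradicting the connectivity cut), and the individualised vertex is
dropped (`not_mem_atom_of_cell_singleton`), which is progress. Consequently (`ORSteps.sum_log_d_le`, `ORSteps.card_fat_mul_le`)
**every such path satisfies the linear per-path bounds** `Σ_k ⌊log₂ d_k⌋ ≤ 4|V| + ⌊log₂|V|⌋` and `(θ_D − 1)·D ≤ 2|V|` — the
per-path Corneil–Goldberg bound for the actual process, leaving to (R2) only the definition of the canonical choices
(`colStar` = colour refinement, `x` in the first smallest cell) and the circuit. One structure, no other definitions.
-/

-- `Summit.PneNP.PneNP.…` duplicates `PneNP` BY DESIGN (single-problem summit, D-0017 layout).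
set_option linter.dupNamespace false

namespace Summit.PneNP.PneNP.Theorems

open Finset

namespace BranchSum

variable {V : Type*} [DecidableEq V] {G : SimpleGraph V} [DecidableRel G.Adj]

/-! ### Singleton cells are switching-isolated -/

omit [DecidableEq V] in
/-- `blockEdges` from a singleton cell: the number of neighbours of its vertex in the other cell. -/
theorem blockEdges_of_cell_singleton {W : Finset V} {c : V → ℕ} {u : V} (hu : cellOf W c u = {u}) (b : V) :
    blockEdges G W c u b = ((cellOf W c b).filter fun y => G.Adj u y).card := by
  unfold blockEdges
  rw [hu, singleton_product, filter_map, card_map]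
  congr 1

omit [DecidableEq V] in
/-- **A vertex alone in its cell of an equitable-inside-`W` colouring has no switching edge inside `W`.** -/
theorem not_swAdj_of_cell_singleton {W : Finset V} {c : V → ℕ}
    (heq : ∀ u ∈ W, ∀ v ∈ W, c u = c v → ∀ w ∈ W,
      ((cellOf W c w).filter fun y => G.Adj u y).card = ((cellOf W c w).filter fun y => G.Adj v y).card)
    {u : V} (hu : u ∈ W) (hsingle : cellOf W c u = {u}) {b : V} (hb : b ∈ W) : ¬ (swGraph G W c).Adj u b := by
  intro hadj
  rw [swGraph_adj] at hadj
  obtain ⟨hne, hiff⟩ := hadj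
  -- every vertex of the cell `C` of `b` has the same number (0 or 1) of neighbours in `{u}`: `u` is complete or empty to `C`
  set C := cellOf W c b with hC
  have hbC : b ∈ C := mem_cellOf_iff.2 ⟨hb, rfl⟩
  have hconst : ∀ y ∈ C, (G.Adj u y ↔ G.Adj u b) := by
    intro y hy
    have hyW : y ∈ W := (mem_cellOf_iff.1 hy).1
    have h := heq y hyW b hb (mem_cellOf_iff.1 hy).2 u hu
    rw [hsingle] at h
    rw [G.adj_comm u y, G.adj_comm u b]
    by_cases hyu : G.Adj y u <;> by_cases hbu : G.Adj b u
    · exact iff_of_true hyu hbu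
    · exfalso; rw [filter_singleton, filter_singleton, if_pos hyu, if_neg hbu] at h; simp at h
    · exfalso; rw [filter_singleton, filter_singleton, if_neg hyu, if_pos hbu] at h; simp at h
    · exact iff_of_false hyu hbu
  have hbe := blockEdges_of_cell_singleton (G := G) hsingle b
  have hcellu : (cellOf W c u).card = 1 := by rw [hsingle, card_singleton]
  by_cases hub : G.Adj u b
  · -- complete block: switched, so a switching edge would be a NON-edge
    have hfull : ((cellOf W c b).filter fun y => G.Adj u y) = cellOf W c b :=
      filter_true_of_mem fun y hy => (hconst y hy).2 hub
    have hcomp : SwComp G W c u b := by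
      unfold SwComp; rw [hbe, hfull, hcellu, one_mul]
      have : 0 < (cellOf W c b).card := card_pos.2 ⟨b, hbC⟩
      omega
    exact (hiff.1 hcomp) hub
  · -- empty block: kept, so a switching edge would be an edge
    have hempty : ((cellOf W c b).filter fun y => G.Adj u y) = ∅ :=
      filter_eq_empty_iff.2 fun y hy h => hub ((hconst y hy).1 h)
    have hncomp : ¬ SwComp G W c u b := by
      unfold SwComp; rw [hbe, hempty, card_empty, mul_zero]; exact Nat.not_lt_zero _
    exact hncomp (hiff.2 hub)

/-- Later rounds of the atom iteration are contained in earlier ones. -/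
theorem iterate_atomStep_anti (W : Finset V) (c : V → ℕ) (v : V) {m n : ℕ} (h : m ≤ n) :
    (fun B => swReach G B c v)^[n] W ⊆ (fun B => swReach G B c v)^[m] W := by
  induction h with
  | refl => exact Subset.rfl
  | step _ ih => exact (iterate_atomStep_succ_subset W c v _).trans ih

/-- A switching-isolated vertex other than the pointer is not reached. -/
theorem not_mem_swReach_of_isolated {W : Finset V} {c : V → ℕ} {u p : V} (hup : u ≠ p)
    (hiso : ∀ b ∈ W, ¬ (swGraph G W c).Adj u b) : u ∉ swReach G W c p := by
  have key : ∀ n, u ∉ (swExpand G W c)^[n] ({p} ∩ W) := by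
    intro n
    induction n with
    | zero => simp [hup]
    | succ n ih =>
      rw [Function.iterate_succ_apply', swExpand, mem_union, not_or]
      refine ⟨ih, fun h => ?_⟩
      rw [mem_filter] at h
      obtain ⟨a, ha, hau⟩ := h.2
      have haW : a ∈ W := iterate_swExpand_subset c inter_subset_right n ha
      exact hiso a haW hau.symm
  exact key _

/-- **The individualised vertex is dropped**: a vertex alone in its cell (of an equitable colouring of `W`) lies outside the
atom of any other pointer. -/
theorem not_mem_atom_of_cell_singleton {W : Finset V} {c : V → ℕ}
    (heq : ∀ u ∈ W, ∀ v ∈ W, c u = c v → ∀ w ∈ W,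
      ((cellOf W c w).filter fun y => G.Adj u y).card = ((cellOf W c w).filter fun y => G.Adj v y).card)
    {u : V} (hu : u ∈ W) (hsingle : cellOf W c u = {u}) {p : V} (hup : u ≠ p) : u ∉ atom G W c p := by
  intro h
  have h1 : u ∈ (fun B => swReach G B c p)^[1] W := iterate_atomStep_anti W c p (by omega) h
  simp only [Function.iterate_one] at h1
  exact not_mem_swReach_of_isolated hup (fun b hb => not_swAdj_of_cell_singleton heq hu hsingle hb) h1

/-- **Cells at an OR-node have at least two elements**: with `≥ 2` vertices, connected switching graph (cut form) and an
equitable colouring, no cell is a singleton. -/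
theorem two_le_card_cellOf {W : Finset V} {c : V → ℕ}
    (heq : ∀ u ∈ W, ∀ v ∈ W, c u = c v → ∀ w ∈ W,
      ((cellOf W c w).filter fun y => G.Adj u y).card = ((cellOf W c w).filter fun y => G.Adj v y).card)
    (hconn : ∀ S ⊆ W, S.Nonempty → S ≠ W → ∃ a ∈ S, ∃ b ∈ W \ S, (swGraph G W c).Adj a b)
    (hW : 2 ≤ W.card) {u : V} (hu : u ∈ W) : 2 ≤ (cellOf W c u).card := by
  by_contra hlt
  have huC : u ∈ cellOf W c u := mem_cellOf_iff.2 ⟨hu, rfl⟩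
  have hsingle : cellOf W c u = {u} := by
    apply eq_singleton_iff_unique_mem.2 ⟨huC, fun y hy => ?_⟩
    by_contra hyu
    have : 2 ≤ (cellOf W c u).card := by
      rw [← card_pair hyu]; exact card_le_card (by
        intro z hz; rw [mem_insert, mem_singleton] at hz; rcases hz with rfl | rfl <;> assumption)
    exact hlt this
  have hS : ({u} : Finset V) ≠ W := fun h => by rw [← h, card_singleton] at hW; omega
  obtain ⟨a, ha, b, hb, hab⟩ := hconn {u} (singleton_subset_iff.2 hu) ⟨u, mem_singleton_self u⟩ hS
  rw [mem_singleton] at ha; subst ha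
  exact not_swAdj_of_cell_singleton heq hu hsingle (mem_sdiff.1 hb).1 hab

variable (G)

/-- **OR-steps of the components-only Corneil–Goldberg process along the path of a pointer.** Node `k < N` carries the block
`W k`, the colouring `col k`, the branching number `d k`; the step at node `k` (when `k + 1 < N`) individualises `x k`, refines
to `colStar k` (equitable inside `W k`, `x k` alone in its cell) and passes to the atom of the pointer `p k ≠ x k`; after the last
OR-node nothing is recorded (`W k = ∅` for `k ≥ N`). Root data: `col 0` equitable inside `W 0` with connected switching graph. -/
structure ORSteps (N : ℕ) where
  /-- block at node `k` (empty from `N` on) -/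
  W : ℕ → Finset V
  /-- colouring at node `k` -/
  col : ℕ → V → ℕ
  /-- refinement after individualising at node `k` -/
  colStar : ℕ → V → ℕ
  /-- branching number -/
  d : ℕ → ℕ
  /-- individualised vertex -/
  x : ℕ → V
  /-- pointer followed -/
  p : ℕ → V
  finalW : ∀ k, N ≤ k → W k = ∅
  two_le_W : ∀ k, k < N → 2 ≤ (W k).card
  equitable0 : ∀ u ∈ W 0, ∀ v ∈ W 0, col 0 u = col 0 v → ∀ w ∈ W 0,
    ((cellOf (W 0) (col 0) w).filter fun y => G.Adj u y).card = ((cellOf (W 0) (col 0) w).filter fun y => G.Adj v y).card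
  connected0 : ∀ S ⊆ W 0, S.Nonempty → S ≠ W 0 → ∃ a ∈ S, ∃ b ∈ W 0 \ S, (swGraph G (W 0) (col 0)).Adj a b
  d_le : ∀ k, ∀ u ∈ W k, d k ≤ (cellOf (W k) (col k) u).card
  star_refines : ∀ k, ∀ u ∈ W k, ∀ v ∈ W k, colStar k u = colStar k v → col k u = col k v
  star_equitable : ∀ k, k + 1 < N → ∀ u ∈ W k, ∀ v ∈ W k, colStar k u = colStar k v → ∀ w ∈ W k,
    ((cellOf (W k) (colStar k) w).filter fun y => G.Adj u y).card =
      ((cellOf (W k) (colStar k) w).filter fun y => G.Adj v y).card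
  x_mem : ∀ k, k + 1 < N → x k ∈ W k
  p_mem : ∀ k, k + 1 < N → p k ∈ W k
  x_ne_p : ∀ k, k + 1 < N → x k ≠ p k
  star_single : ∀ k, k + 1 < N → cellOf (W k) (colStar k) (x k) = {x k}
  nextW : ∀ k, k + 1 < N → W (k + 1) = atom G (W k) (colStar k) (p k)
  col_succ : ∀ k, k + 1 < N → col (k + 1) = colStar k

variable {G} {N : ℕ}

namespace ORSteps

variable (P : ORSteps G N)

/-- Equitability and connectivity hold at every OR-node. -/
theorem equitable_and_connected (k : ℕ) (hk : k < N) :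
    (∀ u ∈ P.W k, ∀ v ∈ P.W k, P.col k u = P.col k v → ∀ w ∈ P.W k,
      ((cellOf (P.W k) (P.col k) w).filter fun y => G.Adj u y).card =
        ((cellOf (P.W k) (P.col k) w).filter fun y => G.Adj v y).card) ∧
    (∀ S ⊆ P.W k, S.Nonempty → S ≠ P.W k → ∃ a ∈ S, ∃ b ∈ P.W k \ S, (swGraph G (P.W k) (P.col k)).Adj a b) := by
  induction k with
  | zero => exact ⟨P.equitable0, P.connected0⟩
  | succ k _ =>
    have hk' : k + 1 < N := hk
    rw [P.nextW k hk', P.col_succ k hk']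
    exact ⟨fun u hu v hv huv w hw => equitableIn_atom (P.p k) (P.star_equitable k hk') hu hv huv hw,
      fun S hS hSne hSA => atom_connected (P.colStar k) (P.p_mem k hk') hS hSne hSA⟩

/-- **OR-steps are transition data** (all of H1–H5). -/
def toTransitionData : TransitionData G N where
  W := P.W
  col := P.col
  colStar := P.colStar
  d := P.d
  nest k := by
    by_cases hk : k + 1 < N
    · rw [P.nextW k hk]; exact atom_subset _ _ _
    · rw [P.finalW (k + 1) (by omega)]; exact empty_subset _
  final := P.finalW N le_rfl
  star_refines := P.star_refines
  next_refines k u hu v hv huv := by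
    by_cases hk : k + 1 < N
    · rw [P.col_succ k hk] at huv; exact huv
    · rw [P.finalW (k + 1) (by omega)] at hu; exact absurd hu (notMem_empty u)
  dropped_homogeneous k v hv hv' u hu u' hu' huu' := by
    by_cases hk : k + 1 < N
    · rw [P.nextW k hk] at hv' hu hu'
      exact atom_homogeneous (P.colStar k) (P.p k) hv hv' hu hu' huu'
    · rw [P.finalW (k + 1) (by omega)] at hu; exact absurd hu (notMem_empty u)
  two_le k u hu := by
    have hk : k < N := by
      by_contra hk; rw [P.finalW k (by omega)] at hu; exact absurd hu (notMem_empty u)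
    obtain ⟨heq, hconn⟩ := P.equitable_and_connected k hk
    exact two_le_card_cellOf heq hconn (P.two_le_W k hk) hu
  d_le := P.d_le
  equitable k u hu v hv huv w hw := by
    have hk : k < N := by
      by_contra hk; rw [P.finalW k (by omega)] at hu; exact absurd hu (notMem_empty u)
    exact (P.equitable_and_connected k hk).1 u hu v hv huv w hw
  connected k S hS hSne hSW := by
    have hk : k < N := by
      by_contra hk; rw [P.finalW k (by omega)] at hS
      obtain ⟨s, hs⟩ := hSne; exact absurd (hS hs) (notMem_empty s)
    exact (P.equitable_and_connected k hk).2 S hS hSne hSW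
  progress k hk := by
    by_cases hk' : k + 1 < N
    · -- the individualised vertex is dropped
      intro h
      have hx := P.x_mem k hk'
      rw [← h, P.nextW k hk'] at hx
      exact not_mem_atom_of_cell_singleton (P.star_equitable k hk') (P.x_mem k hk') (P.star_single k hk') (P.x_ne_p k hk') hx
    · rw [P.finalW (k + 1) (by omega)]
      intro h
      have := P.two_le_W k hk
      rw [← h, card_empty] at this
      omega

/-- **Linear per-path bound for the process, logarithmic form**: `Σ_{k<N} ⌊log₂ d_k⌋ ≤ 4|V| + ⌊log₂|V|⌋`. -/
theorem sum_log_d_le [Fintype V] (P : ORSteps G N) :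
    ∑ k ∈ range N, Nat.log 2 (P.d k) ≤ 4 * Fintype.card V + Nat.log 2 (Fintype.card V) :=
  P.toTransitionData.sum_log_d_le

/-- **Linear per-path bound for the process, fat-node form**: `(θ_D − 1) · D ≤ 2|V|`. -/
theorem card_fat_mul_le [Fintype V] (P : ORSteps G N) (D : ℕ) :
    (((range N).filter fun k => D < P.d k).card - 1) * D ≤ 2 * Fintype.card V :=
  P.toTransitionData.toRefinementPath.card_fat_mul_le D

end ORSteps

end BranchSum

end Summit.PneNP.PneNP.Theorems
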